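import Literature.Topology.Algebra.ProfiniteOutCongruence
import Literature.AnabelianGeometry.Anabelioids.OuterActionOfEquivalence
import Literature.AnabelianGeometry.SemiGraphs.AmbientVocabOfReal
import Literature.AnabelianGeometry.SemiGraphs.AmbientIsoLocallyTrivial

/-!
# `SemiAnbdVocab.ofReal` with the residual reduced to tempered arrows: profinite `Out(π̂₁(G_v))` supplied ([SemiAnbd] Def 2.3 (iii), Def 5.1 (i)(c)) — merge step M7b

Mochizuki, *Semi-graphs of anabelioids*, Publ. RIMS **42** (2006), §2 Def 2.3 (iii) p.25 ("which, as
is well-known, implies that `Out(π̂₁(𝒢_c))` is equipped with a natural profinite group structure"),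
§5 Def 5.1 (i)(c) p.62 ("the resulting outer homomorphism `H → Out(π̂₁(𝒢_v))` [where `Out(π̂₁(𝒢_v))`
is equipped with the natural profinite group topology]") (kurims `paper:url-f33ace170ff4`).
[cite: MochizukiSemiAnbd2006, Def 5.1 (i), p. 62]

THE RESIDUAL (R2) OF `AmbientVocabOfReal.lean` DISCHARGED at the one-universe specialisation
`SgA.{u,u,u}` (the container pins `OutVert` to `ProfiniteGrp.{w}` with `w` the universe of vertices;
the vertex groups `Π_v = Aut F_v` live in `Type (max u₁ v₁)`; the two meet iff `u₁ = v₁ = u` — every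
concrete instance): from abc-iut-w5-d042's bricks

* `Literature.Topology.Algebra.congrOutProfinite` (`ProfiniteOutCongruence.lean`: `Out(G)` of a
  topologically finitely generated profinite group is PROFINITE — Dixon–du Sautoy–Mann–Segal Thm 5.3,
  the "as is well-known" of Def 2.3 (iii)), and
* `Literature.AnabelianGeometry.Anabelioids.outOfEquivalence` (`OuterActionOfEquivalence.lean`: the
  outer automorphism of `π₁(X, F)` induced by a self-equivalence of a connected anabelioid `X`,
  independent of the path),

and from `AmbientIsoLocallyTrivial.lean` (an automorphism of an object of `SgA` has self-EQUIVALENCES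
as constituents), this file builds

* `SgA.piV G v := Aut F_v` (`F_v` the canonical fibre functor of `𝒢_v`), `SgA.outVert G v : ProfiniteGrp`
  (:= `Out(Π_v)` with its profinite topology when `Π_v` is topologically finitely generated — the
  coherent case of Def 2.3 (iii) —, the trivial group otherwise, as `InterfaceVocab.lean` allows);
* `SgA.autAtVertex φ v h` — the self-1-morphism of `𝒢_v` induced by an automorphism `φ` of `G` fixing
  `v` (through a representative, transported along `φ v = v`), an ISOMORPHISM of anabelioids
  (`autAtVertex_isIsomorphism`), and `SgA.outRep φ v h : outVert G v` its outer class;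
* `SgA.TemperedResidual` — the residual REDUCED to (R1) (tempered arrows + 2 laws) — and
  `SgA.BridgeResidual.ofTempered : TemperedResidual → BridgeResidual.{u,u,u}`, whence
  `SemiAnbdVocab.ofRealOfTempered T := SemiAnbdVocab.ofReal (BridgeResidual.ofTempered T)`.

Not claimed here (recorded): that `outRep` is a group homomorphism in `φ` / independent of the
representative (it is, by `outOfEquivalence_comp` and 2-cell invariance — bookkeeping left to the
consumer of Def 5.1 (i)(c)); the (c^new)/(O2) form of [IUTchI] Rmk 2.5.3 (vi) (topology on
`Aut(𝒢[c])`), which the container does not carry.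
-/

namespace Literature.AnabelianGeometry.SemiGraphs

open CategoryTheory CategoryTheory.PreGaloisCategory Literature.AnabelianGeometry.Anabelioids
open Literature.AnabelianGeometry.AbsoluteAnabelian (IsTopologicallyFinitelyGenerated)
open Literature.Topology.Algebra

universe u

/-! ### Invariance of the outer class under isomorphism of the self-equivalence -/

/-- w5-d042's `outOfEquivalence F P` depends on the self-equivalence `P` only up to isomorphism of
functors (a 2-cell `P ≅ P'` conjugates `π₁(P)` into `π₁(P')` by a whiskered path, `pi1Map_of_iso`).
Declared next to its source notion (`Anabelioids/OuterActionOfEquivalence.lean`) by absolute name.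
[cite: MochizukiGeoAn2004, Def. 1.1.2(ii) p.10] -/
theorem _root_.Literature.AnabelianGeometry.Anabelioids.outOfEquivalence_eq_of_iso
    {X : Type u} [Category.{u} X] [GaloisCategory X] (F : X ⥤ FintypeCat.{u}) [FiberFunctor F]
    (P P' : X ⥤ X) [P.IsEquivalence] [P'.IsEquivalence] (i : P ≅ P') :
    outOfEquivalence F P = outOfEquivalence F P' := by
  obtain ⟨e⟩ := nonempty_path F P
  let e' : P' ⋙ F ≅ F := (Functor.isoWhiskerRight i F).symm ≪≫ e
  rw [outOfEquivalence_eq_mk F P e, outOfEquivalence_eq_mk F P' e']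
  congr 1
  apply Subtype.ext
  apply MulEquiv.ext
  intro σ
  rw [contAutOfPath_apply, contAutOfPath_apply, pi1Map_of_iso i F σ, ← Iso.trans_conjAut]
  congr 1
  ext x
  simp [e']

namespace SgAQuot

namespace SgA

variable (G : SgA.{u, u, u})

/-! ### The vertex groups and their profinite `Out` -/

/-- `Π_v := π̂₁(𝒢_v)` at the canonical basepoint of the constituent anabelioid `𝒢_v` (Mathlib's
profinite `Aut` of a fibre functor). [cite: MochizukiSemiAnbd2006, Def. 2.1 p.23] -/
abbrev piV (v : G.toSgA.graph.Vertex) : Type u :=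
  Aut (GaloisCategory.getFiberFunctor (G.toSgA.V v))

open Classical in
/-- **`Out(π̂₁(𝒢_v))` as a profinite group** (Def 2.3 (iii): "equipped with a natural profinite group
structure" when `π̂₁(𝒢_v)` is topologically finitely generated — w5-d042's `congrOutProfinite`, the
congruence topology); the trivial profinite group as junk value otherwise (container convention,
`InterfaceVocab.lean`). [cite: MochizukiSemiAnbd2006, Def. 2.3(iii) p.25] -/
noncomputable def outVert (v : G.toSgA.graph.Vertex) : ProfiniteGrp.{u} :=
  if h : IsTopologicallyFinitelyGenerated (G.piV v) then congrOutProfinite h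
  else ProfiniteGrp.of PUnit.{u + 1}

/-- In the coherent case `outVert` is `Out(Π_v)` with its profinite topology.
[cite: MochizukiSemiAnbd2006, Def. 2.3(iii) p.25] -/
theorem outVert_eq (v : G.toSgA.graph.Vertex) (h : IsTopologicallyFinitelyGenerated (G.piV v)) :
    G.outVert v = congrOutProfinite h := by
  classical
  exact dif_pos h

/-- Outside the coherent case `outVert` is the junk value (trivial profinite group).
[cite: MochizukiSemiAnbd2006, Def. 2.3(iii) p.25] -/
theorem outVert_eq_of_not (v : G.toSgA.graph.Vertex)
    (h : ¬ IsTopologicallyFinitelyGenerated (G.piV v)) :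
    G.outVert v = ProfiniteGrp.of PUnit.{u + 1} := by
  classical
  exact dif_neg h

/-! ### The self-equivalence of `𝒢_v` induced by an automorphism of `G` fixing `v` -/

variable {G}

/-- The self-1-morphism `𝒢_v → 𝒢_v` induced by an automorphism `φ` of `G` fixing the vertex `v`
("an automorphism of `𝒢` fixing `v` induces an automorphism of the anabelioid `𝒢_v`", Def 5.1 (i)(c)):
the vertex component at `v` of the canonical representative of `φ`, transported along `φ v = v`.
[cite: MochizukiSemiAnbd2006, Def 5.1 (i), p. 62] -/
noncomputable def autAtVertex (φ : Aut G) (v : G.toSgA.graph.Vertex)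
    (h : φ.hom.hom.hom.base.vertexMap v = v) : Anabelioids.Hom (G.toSgA.V v) (G.toSgA.V v) :=
  ((Quotient.out φ.hom.hom.hom.cls).φV v).comp (G.toSgA.idV _ _ h)

/-- The canonical representative represents. [cite: MochizukiSemiAnbd2006, Rmk 2.4.2, p. 26] -/
theorem homMk_out (φ : Aut G) : homMk (Quotient.out φ.hom.hom.hom.cls) = φ.hom.hom.hom := by
  rcases hφ : φ.hom.hom.hom with ⟨f, c⟩
  change (⟨f, Quotient.mk _ (Quotient.out c)⟩ : SgAQuot.Hom _ _) = ⟨f, c⟩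
  rw [Quotient.out_eq]

/-- An isomorphism of anabelioids followed by a transported vertex identity is an isomorphism.
[cite: MochizukiSemiAnbd2006, Rmk 2.4.2, p. 26] -/
theorem isEquivalence_comp_idV {𝒢 : SemiGraphOfAnabelioids.{u, u, u}} {v w w' : 𝒢.graph.Vertex}
    (P : Anabelioids.Hom (𝒢.V v) (𝒢.V w)) (h : w = w') (hP : P.pullback.IsEquivalence) :
    (P.comp (𝒢.idV w w' h)).pullback.IsEquivalence := by
  subst h
  change (𝟭 _ ⋙ P.pullback).IsEquivalence
  exact hP

/-- **The induced self-1-morphism of `𝒢_v` is an isomorphism of anabelioids** (automorphisms of the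
Rmk 2.4.2 category are locally trivial, `AmbientIsoLocallyTrivial.lean`).
[cite: MochizukiSemiAnbd2006, Def 5.1 (i), p. 62] -/
theorem autAtVertex_isIsomorphism (φ : Aut G) (v : G.toSgA.graph.Vertex)
    (h : φ.hom.hom.hom.base.vertexMap v = v) : (autAtVertex φ v h).IsIsomorphism := by
  -- the underlying `SgAQuot`-isomorphism
  let a : G.obj.obj ≅ G.obj.obj := (IsAmbientObj.ι ⋙ wideSubcategoryInclusion _).mapIso φ
  have hv : ((Quotient.out φ.hom.hom.hom.cls).φV v).pullback.IsEquivalence :=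
    isEquivalence_φV_of_iso a (Quotient.out φ.hom.hom.hom.cls) (homMk_out φ) v
  -- transport along `φ v = v`
  exact isEquivalence_comp_idV _ h hv

open Classical in
/-- **The outer automorphism of `π̂₁(𝒢_v)` induced by an automorphism of `G` fixing `v`**, as an
element of the PROFINITE `Out(π̂₁(𝒢_v))` (Def 5.1 (i)(c) "the resulting outer homomorphism
`H → Out(π̂₁(𝒢_v))`"): w5-d042's `outOfEquivalence` at the self-equivalence `autAtVertex φ v h`, read in
`congrOutProfinite` through `CongrOut.equivTopOut`; the junk value `1` outside the coherent case.
[cite: MochizukiSemiAnbd2006, Def 5.1 (i), p. 62] -/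
noncomputable def outRep (φ : Aut G) (v : G.toSgA.graph.Vertex)
    (h : φ.hom.hom.hom.base.vertexMap v = v) : G.outVert v :=
  if hfg : IsTopologicallyFinitelyGenerated (G.piV v) then by
    rw [outVert_eq G v hfg]
    haveI : (autAtVertex φ v h).pullback.IsEquivalence := autAtVertex_isIsomorphism φ v h
    exact (CongrOut.equivTopOut (G := G.piV v)).symm
      (outOfEquivalence (GaloisCategory.getFiberFunctor (G.toSgA.V v)) (autAtVertex φ v h).pullback)
  else by
    rw [outVert_eq_of_not G v hfg]
    exact 1

/-- Computation rule in the coherent case (up to the transport along `outVert_eq`): `outRep φ v h` IS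
the profinite-`Out` class of the outer automorphism induced by `autAtVertex φ v h`.
[cite: MochizukiSemiAnbd2006, Def 5.1 (i), p. 62] -/
theorem outRep_heq (φ : Aut G) (v : G.toSgA.graph.Vertex) (h : φ.hom.hom.hom.base.vertexMap v = v)
    (hfg : IsTopologicallyFinitelyGenerated (G.piV v)) :
    haveI : (autAtVertex φ v h).pullback.IsEquivalence := autAtVertex_isIsomorphism φ v h
    HEq (outRep φ v h) ((CongrOut.equivTopOut (G := G.piV v)).symm
      (outOfEquivalence (GaloisCategory.getFiberFunctor (G.toSgA.V v)) (autAtVertex φ v h).pullback)) := by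
  unfold outRep
  rw [dif_pos hfg, eq_mpr_eq_cast]
  exact cast_heq _ _

/-- **`outRep` may be computed with ANY representative** `ψ` of `φ` (2-isomorphic representatives
induce isomorphic self-equivalences of `𝒢_v`, hence the same outer class —
`outOfEquivalence_eq_of_iso`). [cite: MochizukiSemiAnbd2006, Def 5.1 (i), p. 62] -/
theorem outRep_heq_of_rep (φ : Aut G) (ψ : SemiGraphOfAnabelioids.HomOver G.toSgA G.toSgA φ.hom.hom.hom.base)
    (hψ : homMk ψ = φ.hom.hom.hom) (v : G.toSgA.graph.Vertex)
    (h : φ.hom.hom.hom.base.vertexMap v = v) (hfg : IsTopologicallyFinitelyGenerated (G.piV v))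
    (hE : ((ψ.φV v).comp (G.toSgA.idV _ _ h)).pullback.IsEquivalence) :
    HEq (outRep φ v h) ((CongrOut.equivTopOut (G := G.piV v)).symm
      (outOfEquivalence (GaloisCategory.getFiberFunctor (G.toSgA.V v))
        ((ψ.φV v).comp (G.toSgA.idV _ _ h)).pullback)) := by
  haveI : (autAtVertex φ v h).pullback.IsEquivalence := autAtVertex_isIsomorphism φ v h
  obtain ⟨σ⟩ := (homMk_eq_homMk_iff _ _).mp ((homMk_out φ).trans hψ.symm)
  have key : outOfEquivalence (GaloisCategory.getFiberFunctor (G.toSgA.V v))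
        (autAtVertex φ v h).pullback =
      outOfEquivalence (GaloisCategory.getFiberFunctor (G.toSgA.V v))
        ((ψ.φV v).comp (G.toSgA.idV _ _ h)).pullback :=
    outOfEquivalence_eq_of_iso _ _ _
      (Functor.isoWhiskerLeft (G.toSgA.idV _ _ h).pullback (σ.isoV v))
  rw [← key]
  exact outRep_heq φ v h hfg

/-- The self-equivalence computed from any representative of an automorphism IS an equivalence
(hypothesis `hE` of `outRep_heq_of_rep` discharged). [cite: MochizukiSemiAnbd2006, Def 5.1 (i), p. 62] -/
theorem isEquivalence_rep_comp_idV (φ : Aut G) (ψ : SemiGraphOfAnabelioids.HomOver G.toSgA G.toSgA φ.hom.hom.hom.base)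
    (hψ : homMk ψ = φ.hom.hom.hom) (v : G.toSgA.graph.Vertex)
    (h : φ.hom.hom.hom.base.vertexMap v = v) :
    ((ψ.φV v).comp (G.toSgA.idV _ _ h)).pullback.IsEquivalence :=
  isEquivalence_comp_idV _ h (isEquivalence_φV_of_iso
    ((IsAmbientObj.ι ⋙ wideSubcategoryInclusion _).mapIso φ) ψ hψ v)

/-- Computation rule outside the coherent case: the junk value `1`.
[cite: MochizukiSemiAnbd2006, Def 5.1 (i), p. 62] -/
theorem outRep_heq_one (φ : Aut G) (v : G.toSgA.graph.Vertex) (h : φ.hom.hom.hom.base.vertexMap v = v)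
    (hfg : ¬ IsTopologicallyFinitelyGenerated (G.piV v)) :
    HEq (outRep φ v h) (1 : ProfiniteGrp.of PUnit.{u + 1}) := by
  unfold outRep
  rw [dif_neg hfg, eq_mpr_eq_cast]
  exact cast_heq _ _

/-! ### The reduced residual and the bridge -/

/-- **The residual of the L3 bridge REDUCED to (R1)**: the class of tempered arrows `𝒢' → 𝒢`
([SemiAnbd] Def 3.5 (ii) p.37: a covering of a countable `𝒢` split componentwise by some finite étale
covering — typed in t2's `ProfiniteSemiGraph` model only) with its two formal laws.  A PARAMETER;
nothing is asserted about it. [cite: MochizukiSemiAnbd2006, Def 3.5 (ii), p. 37] -/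
structure TemperedResidual where
  /-- (R1) tempered arrows `𝒢' → 𝒢` (Def 3.5 (ii), p.37) -/
  IsTempered : ∀ {G H : SgA.{u, u, u}}, (G ⟶ H) → Prop
  /-- (R1) `B(G) ↪ B^temp(G)`: finite étale coverings are tempered (Def 3.5 (ii), p.37) -/
  isTempered_of_finiteEtale : ∀ {G H : SgA.{u, u, u}} (f : G ⟶ H),
    finiteEtale f.hom.hom → IsTempered f
  /-- (R1) tempered coverings are locally finite étale (Def 3.5 (ii) with Rmk 3.5.2, p.38) -/
  locallyFiniteEtale_of_isTempered : ∀ {G H : SgA.{u, u, u}} (f : G ⟶ H),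
    IsTempered f → locallyFiniteEtale f.hom.hom

/-- **(R2) discharged**: the full bridge residual from the reduced one — `OutVert := outVert`
(profinite `Out(π̂₁(𝒢_v))`), `outRep := outRep`. [cite: MochizukiSemiAnbd2006, Def 5.1 (i), p. 62] -/
noncomputable def BridgeResidual.ofTempered (T : TemperedResidual.{u}) : BridgeResidual.{u, u, u} where
  IsTempered f := T.IsTempered f
  isTempered_of_finiteEtale f h := T.isTempered_of_finiteEtale f h
  locallyFiniteEtale_of_isTempered f h := T.locallyFiniteEtale_of_isTempered f h
  OutVert G v := G.outVert v
  outRep φ v h := SgA.outRep φ v h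

end SgA

end SgAQuot

/-- **`SemiAnbdVocab.ofReal` with the residual reduced to tempered arrows**: the §§4–5 container at
the real vocabulary `SgA.{u,u,u}`, every field real except (R1).
[cite: MochizukiSemiAnbd2006, Rmk 2.4.2, p. 26] -/
noncomputable def SemiAnbdVocab.ofRealOfTempered (T : SgAQuot.SgA.TemperedResidual.{u}) :
    SemiAnbdVocab SgAQuot.SgA.{u, u, u} :=
  SemiAnbdVocab.ofReal (SgAQuot.SgA.BridgeResidual.ofTempered T)

/-- The `Out(π̂₁(𝒢_v))` of `ofRealOfTempered` is the profinite `Out` of the coherent case.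
[cite: MochizukiSemiAnbd2006, Def. 2.3(iii) p.25] -/
theorem SemiAnbdVocab.ofRealOfTempered_outVert (T : SgAQuot.SgA.TemperedResidual.{u})
    (G : SgAQuot.SgA.{u, u, u}) (v : G.toSgA.graph.Vertex)
    (h : IsTopologicallyFinitelyGenerated (SgAQuot.SgA.piV G v)) :
    (SemiAnbdVocab.ofRealOfTempered T).OutVert G v = congrOutProfinite h :=
  SgAQuot.SgA.outVert_eq G v h

end Literature.AnabelianGeometry.SemiGraphs
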